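import Mathlib

/-!
# Determinantal ideals, the bideterminants `(K_σ | K_σ)`, and the Andrews–Forbes reduction

Named fact (D-0014, sorry-free `def … : Prop`) vendoring Proposition 3.5 of

* R. Andrews, M. A. Forbes, *Ideals, determinants, and straightening: proving and using lower bounds
  for polynomial ideals*, STOC 2022, arXiv:2112.00792 (read: §2 p. 11, §2.1 Def. 2.1, §2.5
  Defs. 2.21–2.23, Thms. 2.24–2.25, Cor. 2.26, §3.1 pp. 19–21, Prop. 3.5 p. 21) [`AndrewsForbes2022`]:

> **Proposition 3.5.** Let `f(X) ∈ I^det_{n,m,r}` be nonzero. There is a collection of `nm` linearly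
> independent linear functions `ℓ_{i,j}(X, ε) ∈ 𝔽(ε)[X]` indexed by `(i,j) ∈ [n] × [m]`, an integer
> `q ∈ ℤ`, a nonzero `α ∈ 𝔽`, and a partition `σ` with `σ₁ ≥ r` such that
> `f(ℓ_{1,1}(X,ε), …, ℓ_{n,m}(X,ε)) = ε^q α (K_σ | K_σ)(X) + O(ε^{q+1})`.

Here (§2, p. 11) `X = (x_{i,j})` is an `n × m` matrix of variables and `I^det_{n,m,r} ⊆ 𝔽[X]` is the
ideal generated by the `r × r` minors of `X` (`r ≤ min(n, m)`); `(S | T)(X)` is the bideterminant of a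
bitableau (Def. 2.23: the product over the rows `i` of the minors of `X` with row indices `S(i, ·)`
and column indices `T(i, ·)`), and `K_σ` is the tableau of shape `σ` whose `i`-th row is
`(1, …, σ_i)` (§3.1, p. 19), so that

  `(K_σ | K_σ)(X) = ∏ᵢ det X_{[σᵢ],[σᵢ]}`

is the product of the LEADING PRINCIPAL minors of `X` of sizes `σ₁ ≥ σ₂ ≥ ⋯` (this is all of the
bideterminant calculus the statement needs, `kBideterminant`); "`g = h + O(ε^{k})`" for
`g, h ∈ 𝔽(ε)[X]` means that every coefficient of `g - h` lies in `ε^{k} 𝔽⟦ε⟧` inside `𝔽((ε))`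
(Def. 2.1 and the conventions of §2.1), written here through Mathlib's embedding
`RatFunc F → LaurentSeries F` as the vanishing of all Laurent coefficients of index `< k`
(`IsBigOEps`). The `nm` linearly independent linear functions are the entries of `c • X` for an
invertible `nm × nm` matrix `c` over `𝔽(ε)` (homogeneous linear forms, as in the proof of the
proposition: `X ↦ M X N` composed with scalings `x_{i,j} ↦ ε^{d_{i,j}} x_{i,j}`; `nm` linear forms in
the `nm` variables are linearly independent iff their coefficient matrix is invertible).

Scope as vendored: `𝔽` a field of characteristic zero (the paper states its results over
characteristic zero, §1.3 p. 7; the item asks for char 0), `1 ≤ r ≤ min(n, m)`; `σ₁ ≥ r` is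
`r ≤ σ.sup` for the multiset `σ` of (positive) parts, all `≤ min(n, m)` so that every factor of
`(K_σ | K_σ)(X)` is a genuine minor of `X`.

The fact `AndrewsForbes2022_prop_3_5` is wanted by the `MatrixMultiplication` routes through the
determinantal-ideal line (crux `EquationsMultiplyMatrices`; cf. route `DeterminantalIdealExponent`,
crux `AndrewsLifting`): it is the straightening-law step of Andrews–Forbes / Andrews 2022.

Mathlib/tree search (2026-08-15): Mathlib has the generic matrix `Matrix.mvPolynomialX`, `RatFunc`,
`LaurentSeries` with the coercion `RatFunc F → F⸨X⸩` (`RatFunc.coeToLaurentSeries`, `RatFunc.coe_X`),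
but no determinantal ideals, (bi)tableaux/bideterminants or straightening law; the tree has none
either (`lean search detIdeal|determinantalIdeal|bideterminant`: no hits).

What is NOT here: general bitableaux and bideterminants `(S | T)`, the standard bideterminant basis
and the straightening law (Thms. 2.24–2.25), Cor. 2.26, Lemma 3.4 (the matrices `M, N`), the ABP /
oracle-circuit half of §3 and the Pfaffian analogues (§3.3); no proof.

## References

* R. Andrews, M. A. Forbes, STOC 2022, doi:10.1145/3519935.3520025, arXiv:2112.00792, Prop. 3.5.
  [`AndrewsForbes2022`]
* J. Désarménien, J. P. S. Kung, G.-C. Rota, *Invariant theory, Young bitableaux, and combinatorics*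
  (1978); C. De Concini, D. Eisenbud, C. Procesi, *Young diagrams and determinantal varieties* (1980)
  — the straightening law behind the proposition (cited through the paper).
-/

noncomputable section

namespace Literature.Computability.AlgebraicComplexity

open MvPolynomial Matrix

section Defs

variable (F : Type*) [Field F]

/-- The **determinantal ideal** `I^det_{n,m,r} ⊆ 𝔽[X]`, `X = (x_{i,j})` the generic `n × m` matrix
(Mathlib's `Matrix.mvPolynomialX`): the ideal generated by the `r × r` minors of `X`
(Andrews–Forbes 2022, §2 p. 11). Generators are written as `det (X.submatrix ρ γ)` over all index maps
`ρ : Fin r → Fin n`, `γ : Fin r → Fin m`; non-injective maps give `0` and reorderings give `±` a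
minor, so the span is the ideal generated by the `r × r` minors. [cite: AndrewsForbes2022, §2 (Preliminaries)] -/
def detIdeal (n m r : ℕ) : Ideal (MvPolynomial (Fin n × Fin m) F) :=
  Ideal.span {p | ∃ (ρ : Fin r → Fin n) (γ : Fin r → Fin m),
    p = ((mvPolynomialX (Fin n) (Fin m) F).submatrix ρ γ).det}

/-- The **leading principal `s × s` minor** `det X_{[s],[s]}` of the generic `n × m` matrix (rows and
columns `1, …, s`); the documented junk value `0` is returned when `s > min(n, m)` (never used below:
all parts of the partitions occurring are `≤ min(n, m)`). [cite: AndrewsForbes2022, Def. 2.23 and §3.1] -/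
def leadingMinor (n m s : ℕ) : MvPolynomial (Fin n × Fin m) F :=
  if h : s ≤ n ∧ s ≤ m then
    ((mvPolynomialX (Fin n) (Fin m) F).submatrix (Fin.castLE h.1) (Fin.castLE h.2)).det
  else 0

/-- The bideterminant **`(K_σ | K_σ)(X) = ∏ᵢ det X_{[σᵢ],[σᵢ]}`** of the bitableau `(K_σ, K_σ)`,
`K_σ` being the tableau of shape `σ` with `i`-th row `(1, …, σᵢ)` (Andrews–Forbes 2022, §3.1 p. 19,
with Def. 2.23): the product of the leading principal minors of sizes the parts of `σ` (recorded as a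
multiset of parts; the product does not depend on their order). [cite: AndrewsForbes2022, §3.1 and Def. 2.23] -/
def kBideterminant (n m : ℕ) (σ : Multiset ℕ) : MvPolynomial (Fin n × Fin m) F :=
  (σ.map (leadingMinor F n m)).prod

/-- `g ∈ 𝔽(ε)` is **`O(ε^k)`**: its Laurent expansion at `ε = 0` (Mathlib's embedding
`RatFunc F → LaurentSeries F`) has no term of degree `< k`, i.e. `g ∈ ε^k 𝔽⟦ε⟧` inside `𝔽((ε))`
(Andrews–Forbes 2022, Def. 2.1 / §2.1 conventions for `O(ε)`). [cite: AndrewsForbes2022, Def. 2.1] -/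
def IsBigOEps (k : ℤ) (g : RatFunc F) : Prop :=
  ∀ i : ℤ, i < k → (g : LaurentSeries F).coeff i = 0

variable {F}

/-- Unfolding `leadingMinor` inside the range `s ≤ n`, `s ≤ m`. [folklore] -/
theorem leadingMinor_of_le {n m s : ℕ} (hn : s ≤ n) (hm : s ≤ m) :
    leadingMinor F n m s =
      ((mvPolynomialX (Fin n) (Fin m) F).submatrix (Fin.castLE hn) (Fin.castLE hm)).det := by
  rw [leadingMinor, dif_pos ⟨hn, hm⟩]

/-- The empty partition gives `(K_∅ | K_∅)(X) = 1`. [folklore] -/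
@[simp] theorem kBideterminant_zero (n m : ℕ) : kBideterminant F n m 0 = 1 := by
  simp [kBideterminant]

/-- Adding a part multiplies by the corresponding leading principal minor. [folklore] -/
theorem kBideterminant_cons (n m s : ℕ) (σ : Multiset ℕ) :
    kBideterminant F n m (s ::ₘ σ) = leadingMinor F n m s * kBideterminant F n m σ := by
  simp [kBideterminant]

/-- `0` is `O(ε^k)` for every `k`. [folklore] -/
theorem isBigOEps_zero (k : ℤ) : IsBigOEps F k 0 := fun i _ => by simp

end Defs

/-- **Andrews–Forbes 2022, Proposition 3.5** (reduction of a nonzero element of the determinantal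
ideal to a single bideterminant `(K_σ | K_σ)` of width `≥ r`, up to `O(ε)`, under a border-linear
change of variables): for a field `𝔽` of characteristic zero, `1 ≤ r ≤ min(n, m)` and a nonzero
`f ∈ I^det_{n,m,r}`, there are an invertible `nm × nm` matrix `c` over `𝔽(ε)` (equivalently: `nm`
linearly independent linear forms `ℓ_{i,j}(X, ε) = Σ_{k,l} c_{(i,j),(k,l)} x_{k,l} ∈ 𝔽(ε)[X]`), an
integer `q`, a nonzero `α ∈ 𝔽` and a partition `σ` (multiset of positive parts `≤ min(n, m)`) with
`σ₁ ≥ r`, such that `f(ℓ_{1,1}, …, ℓ_{n,m}) = ε^q α (K_σ | K_σ)(X) + O(ε^{q+1})` coefficientwise in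
`𝔽(ε)[X]`. [cite: AndrewsForbes2022, Prop. 3.5] -/
def AndrewsForbes2022_prop_3_5 : Prop :=
  ∀ (F : Type) [Field F] [CharZero F] (n m r : ℕ), 0 < r → r ≤ min n m →
  ∀ f : MvPolynomial (Fin n × Fin m) F, f ∈ detIdeal F n m r → f ≠ 0 →
    ∃ (c : Matrix (Fin n × Fin m) (Fin n × Fin m) (RatFunc F)) (q : ℤ) (α : F) (σ : Multiset ℕ),
      IsUnit c ∧ α ≠ 0 ∧ r ≤ σ.sup ∧ (∀ s ∈ σ, 0 < s ∧ s ≤ min n m) ∧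
      ∀ e : (Fin n × Fin m) →₀ ℕ,
        IsBigOEps F (q + 1) (MvPolynomial.coeff e
          (MvPolynomial.aeval
              (fun ij : Fin n × Fin m =>
                ∑ kl : Fin n × Fin m, MvPolynomial.C (c ij kl) * MvPolynomial.X kl) f -
            MvPolynomial.C (RatFunc.X ^ q * algebraMap F (RatFunc F) α) *
              MvPolynomial.map (algebraMap F (RatFunc F)) (kBideterminant F n m σ)))

end Literature.Computability.AlgebraicComplexity
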